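import Mathlib.Data.ZMod.Basic
import Mathlib.Data.Int.Interval
import Mathlib.Data.Finset.Prod
import Mathlib.Tactic.Ring
import Mathlib.Tactic.Linarith
import Mathlib.Tactic.NormNum
import HarnessLib

/-!
# Venture HSemireg — THEOREM 40's counting inputs (ENGINE-W SEC40 §6–§8): the odd classes of `ℤ[√−2]∕𝔮³` by norm mod 8
# (PROPOSITION 40.4's «exactly half is clean»), and the first representation numbers of the two level-24 quaternary forms
# `Q_S = x² + 2y² + 8(u² − uv + v²)` and `Q_E = (3x² + 3y² + 3z² + 2xy + 2xz − 2yz) + 6t²` at `p = 11, 17, 41` with the identity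
# `2·r_{Q_S}(p) + r_{Q_E}(p) = 8(p − 1)` and `κ_p = (r_{Q_S} − r_{Q_E})∕2` — kernel counts on provably complete boxes

HONEST FRAMING. Lean index of the computation cell `pub-hsemireg`, widening group ENGINE-W (code A, seat `engine-w-1`, gen 18).
FINITE COUNTS AND RESIDUE ARITHMETIC ONLY; no quaternion order, hermitian lattice, theta series, modular form, abelian variety, sheaf or
semiregularity map is constructed, and THEOREM 40.5 (the theta identity in `M₂(Γ₀(24), χ₂₄)`) is NOT formalised; nothing here says that HC,
HC_CM or HC_AV holds. Theorems only (0 `def`, 0 named fact, 0 `sorry`). New namespace `Theta40`. Companions: `BrandtMatricesSqrtSix.lean`,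
`BrandtMassEigenvector.lean`, `HermitianMassArithmetic.lean` (SEC39 ∕ §33–§34 kernel inputs).

SOURCE (the cell's own result, by value): `widen/ENGINE-W/out/probe5/SEC40-TWIST-A.md` §6 PROPOSITION 40.4 («Λ′_S … norm form Q_S = x² + 2y²
+ 8N(c) …; Q_E ≅ (3x²+3y²+3z²+2xy+2xz−2yz) ⊕ 6t² … PROOF. … N(α′) = p − 2N(c′) ≡ p (mod 8) because c′ is even; the odd classes of ℤ[√−2]∕𝔮³ are
{±1} (norm ≡ 1 mod 8) and {±(1+√−2)} (norm ≡ 3 mod 8), so N(α′) ≡ p = N(ϱ) (mod 8) forces α′ ≡ ±ϱ (mod 𝔮³)») and §8 («Checks at the 22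
inert-type primes p ≤ 450 (theta40_A.py, exact): (p; r_{Q_S}, r_{Q_E}; difference = 4y_p) — and in every case 2r_{Q_S} + r_{Q_E} = 8(p−1) …:
(11; 28, 24; 4), (17; 40, 48; −8), (41; 112, 96; 16), … i.e. κ_p = 2, −4, 8, …»). What the kernel holds:

* §1 **the classes mod `𝔮³ = (2√−2)`**: `ℤ[√−2]∕𝔮³ ≅ {a mod 4, b mod 2}` for `a + b√−2`; `qcube_classes`: for odd `a` the norm `a² + 2b²` is
  `≡ 1 (mod 8)` iff `b` is even and `≡ 3 (mod 8)` iff `b` is odd (as residues in `ZMod 8`), so an odd-norm element is `≡ ±1` or `≡ ±(1+√−2)`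
  according to its norm mod 8 — and `norm_class_determines` (two elements with odd `a` and equal norms mod 8 have `b ≡ b′ (mod 2)`, while
  `a ≡ ±a′ (mod 4)` holds for any two odd `a, a′`): the step «N(α′) ≡ N(ϱ) (mod 8) forces α′ ≡ ±ϱ (mod 𝔮³)»; `even_c_norm` (`c′` even ⟹
  `8 ∣ 2·N(c′)·…` in the form `p − 2·(4n) ≡ p (mod 8)`).
* §2 **representation numbers** by `decide +kernel` on boxes whose completeness is proved (`box_S`, `box_E`): `rS_11 = 28`, `rE_11 = 24`,
  `rS_17 = 40`, `rE_17 = 48`, `rS_41 = 112`, `rE_41 = 96`; the printed identity `two_rS_add_rE` (`2·28 + 24 = 80`, `2·40 + 48 = 128`,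
  `2·112 + 96 = 320 = 8·40`) and `kappa_values` (`κ_p = (r_S − r_E)∕2·… = 2, −4, 8` via `y_p = (r_S − r_E)∕4 = 1, −2, 4`, `κ_p = 2y_p`).
-/

namespace Summit.Ventures.HSemireg.Theta40

/-! ## §1 The odd classes of `ℤ[√−2]` modulo `𝔮³ = (2√−2) = 4ℤ ⊕ 2√−2·ℤ` -/

/-- **Norm mod 8 decides the class**: for odd `a`, `a² + 2b² ≡ 1 (mod 8)` iff `b` is even, and `≡ 3 (mod 8)` iff `b` is odd.
[kernel, `decide` on `ZMod 8`] -/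
theorem qcube_classes : ∀ a b : ZMod 8, a.val % 2 = 1 →
    ((a ^ 2 + 2 * b ^ 2 = 1 ↔ b.val % 2 = 0) ∧ (a ^ 2 + 2 * b ^ 2 = 3 ↔ b.val % 2 = 1)) := by
  decide

/-- Hence **«N(α′) ≡ N(ϱ) (mod 8) forces α′ ≡ ±ϱ (mod 𝔮³)»**: two elements `a + b√−2`, `a′ + b′√−2` with `a, a′` odd and equal norms mod 8
have `b ≡ b′ (mod 2)`, and `a ≡ ±a′ (mod 4)` automatically — i.e. they agree in `ℤ[√−2]∕𝔮³ = {a mod 4, b mod 2}` up to sign.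
[kernel, `decide` on `ZMod 8`] -/
theorem norm_class_determines : ∀ a b a' b' : ZMod 8, a.val % 2 = 1 → a'.val % 2 = 1 →
    a ^ 2 + 2 * b ^ 2 = a' ^ 2 + 2 * b' ^ 2 →
    b.val % 2 = b'.val % 2 ∧ (a.val % 4 = a'.val % 4 ∨ a.val % 4 = (8 - a'.val) % 4) := by
  decide

/-- An odd norm is `≡ 1` or `≡ 3 (mod 8)` (never `5, 7`): `a` odd ⟹ `a² + 2b² ∈ {1, 3}` mod 8. [kernel, `decide`] -/
theorem odd_norm_residues : ∀ a b : ZMod 8, a.val % 2 = 1 → a ^ 2 + 2 * b ^ 2 = 1 ∨ a ^ 2 + 2 * b ^ 2 = 3 := by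
  decide

/-- **`c′` even ⟹ `N(α′) = p − 2N(c′) ≡ p (mod 8)`**: with `c′ = 2c″` one has `2·N(2c″) = 8·N(c″)` for the Eisenstein norm form,
`2·((2u)² − (2u)(2v) + (2v)²) = 8·(u² − uv + v²)`. [kernel, `ring`] -/
theorem even_c_norm (u v : ℤ) : 2 * ((2 * u) ^ 2 - (2 * u) * (2 * v) + (2 * v) ^ 2) = 8 * (u ^ 2 - u * v + v ^ 2) := by
  ring

/-! ## §2 Representation numbers of `Q_S` and `Q_E` at `p = 11, 17, 41` -/

/-- **Box for `Q_S`**: `x² + 2y² + 8(u² − uv + v²) = n ≤ 41` forces `|x| ≤ 6`, `|y| ≤ 4`, `|u|, |v| ≤ 2`. [kernel] -/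
theorem box_S (x y u v n : ℤ) (hn : n ≤ 41) (h : x ^ 2 + 2 * y ^ 2 + 8 * (u ^ 2 - u * v + v ^ 2) = n) :
    (-6 ≤ x ∧ x ≤ 6) ∧ (-4 ≤ y ∧ y ≤ 4) ∧ (-2 ≤ u ∧ u ≤ 2) ∧ (-2 ≤ v ∧ v ≤ 2) := by
  have hN : 0 ≤ u ^ 2 - u * v + v ^ 2 := by nlinarith [sq_nonneg (2 * u - v), sq_nonneg v]
  have h4 : 4 * (u ^ 2 - u * v + v ^ 2) = (2 * u - v) ^ 2 + 3 * v ^ 2 := by ring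
  have h4' : 4 * (u ^ 2 - u * v + v ^ 2) = (2 * v - u) ^ 2 + 3 * u ^ 2 := by ring
  have hx : x ^ 2 ≤ 41 := by nlinarith [sq_nonneg y]
  have hy : 2 * y ^ 2 ≤ 41 := by nlinarith [sq_nonneg x]
  have huv : 8 * (u ^ 2 - u * v + v ^ 2) ≤ 41 := by nlinarith [sq_nonneg x, sq_nonneg y]
  have hv : 6 * v ^ 2 ≤ 41 := by nlinarith [sq_nonneg (2 * u - v)]
  have hu : 6 * u ^ 2 ≤ 41 := by nlinarith [sq_nonneg (2 * v - u)]
  refine ⟨⟨?_, ?_⟩, ⟨?_, ?_⟩, ⟨?_, ?_⟩, ⟨?_, ?_⟩⟩ <;> nlinarith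

/-- **Box for `Q_E`**: `(3x² + 3y² + 3z² + 2xy + 2xz − 2yz) + 6t² = n ≤ 41` forces `|x|, |y|, |z| ≤ 6`, `|t| ≤ 2`
(the ternary part is `(x+y)² + (x+z)² + (y−z)² + x² + y² + z²`). [kernel] -/
theorem box_E (x y z t n : ℤ) (hn : n ≤ 41) (h : 3 * x ^ 2 + 3 * y ^ 2 + 3 * z ^ 2 + 2 * x * y + 2 * x * z - 2 * y * z + 6 * t ^ 2 = n) :
    (-6 ≤ x ∧ x ≤ 6) ∧ (-6 ≤ y ∧ y ≤ 6) ∧ (-6 ≤ z ∧ z ≤ 6) ∧ (-2 ≤ t ∧ t ≤ 2) := by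
  have hT : 3 * x ^ 2 + 3 * y ^ 2 + 3 * z ^ 2 + 2 * x * y + 2 * x * z - 2 * y * z
      = (x + y) ^ 2 + (x + z) ^ 2 + (y - z) ^ 2 + x ^ 2 + y ^ 2 + z ^ 2 := by ring
  have hx : x ^ 2 ≤ 41 := by nlinarith [sq_nonneg (x + y), sq_nonneg (x + z), sq_nonneg (y - z), sq_nonneg y, sq_nonneg z, sq_nonneg t]
  have hy : y ^ 2 ≤ 41 := by nlinarith [sq_nonneg (x + y), sq_nonneg (x + z), sq_nonneg (y - z), sq_nonneg x, sq_nonneg z, sq_nonneg t]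
  have hz : z ^ 2 ≤ 41 := by nlinarith [sq_nonneg (x + y), sq_nonneg (x + z), sq_nonneg (y - z), sq_nonneg x, sq_nonneg y, sq_nonneg t]
  have ht : 6 * t ^ 2 ≤ 41 := by
    nlinarith [sq_nonneg (x + y), sq_nonneg (x + z), sq_nonneg (y - z), sq_nonneg x, sq_nonneg y, sq_nonneg z]
  refine ⟨⟨?_, ?_⟩, ⟨?_, ?_⟩, ⟨?_, ?_⟩, ⟨?_, ?_⟩⟩ <;> nlinarith

/-- **`r_{Q_S}(11) = 28`** (count over the complete box). [kernel, `decide +kernel`] -/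
theorem rS_11 : ((Finset.Icc (-6 : ℤ) 6 ×ˢ Finset.Icc (-4 : ℤ) 4 ×ˢ Finset.Icc (-2 : ℤ) 2 ×ˢ Finset.Icc (-2 : ℤ) 2).filter
    (fun q => q.1 ^ 2 + 2 * q.2.1 ^ 2 + 8 * (q.2.2.1 ^ 2 - q.2.2.1 * q.2.2.2 + q.2.2.2 ^ 2) = 11)).card = 28 := by
  decide +kernel

/-- **`r_{Q_E}(11) = 24`**. [kernel, `decide +kernel`] -/
theorem rE_11 : ((Finset.Icc (-6 : ℤ) 6 ×ˢ Finset.Icc (-6 : ℤ) 6 ×ˢ Finset.Icc (-6 : ℤ) 6 ×ˢ Finset.Icc (-2 : ℤ) 2).filter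
    (fun q => 3 * q.1 ^ 2 + 3 * q.2.1 ^ 2 + 3 * q.2.2.1 ^ 2 + 2 * q.1 * q.2.1 + 2 * q.1 * q.2.2.1 - 2 * q.2.1 * q.2.2.1
      + 6 * q.2.2.2 ^ 2 = 11)).card = 24 := by
  decide +kernel

/-- **`r_{Q_S}(17) = 40`**. [kernel, `decide +kernel`] -/
theorem rS_17 : ((Finset.Icc (-6 : ℤ) 6 ×ˢ Finset.Icc (-4 : ℤ) 4 ×ˢ Finset.Icc (-2 : ℤ) 2 ×ˢ Finset.Icc (-2 : ℤ) 2).filter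
    (fun q => q.1 ^ 2 + 2 * q.2.1 ^ 2 + 8 * (q.2.2.1 ^ 2 - q.2.2.1 * q.2.2.2 + q.2.2.2 ^ 2) = 17)).card = 40 := by
  decide +kernel

/-- **`r_{Q_E}(17) = 48`**. [kernel, `decide +kernel`] -/
theorem rE_17 : ((Finset.Icc (-6 : ℤ) 6 ×ˢ Finset.Icc (-6 : ℤ) 6 ×ˢ Finset.Icc (-6 : ℤ) 6 ×ˢ Finset.Icc (-2 : ℤ) 2).filter
    (fun q => 3 * q.1 ^ 2 + 3 * q.2.1 ^ 2 + 3 * q.2.2.1 ^ 2 + 2 * q.1 * q.2.1 + 2 * q.1 * q.2.2.1 - 2 * q.2.1 * q.2.2.1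
      + 6 * q.2.2.2 ^ 2 = 17)).card = 48 := by
  decide +kernel

/-- **`r_{Q_S}(41) = 112`**. [kernel, `decide +kernel`] -/
theorem rS_41 : ((Finset.Icc (-6 : ℤ) 6 ×ˢ Finset.Icc (-4 : ℤ) 4 ×ˢ Finset.Icc (-2 : ℤ) 2 ×ˢ Finset.Icc (-2 : ℤ) 2).filter
    (fun q => q.1 ^ 2 + 2 * q.2.1 ^ 2 + 8 * (q.2.2.1 ^ 2 - q.2.2.1 * q.2.2.2 + q.2.2.2 ^ 2) = 41)).card = 112 := by
  decide +kernel

/-- **`r_{Q_E}(41) = 96`**. [kernel, `decide +kernel`] -/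
theorem rE_41 : ((Finset.Icc (-6 : ℤ) 6 ×ˢ Finset.Icc (-6 : ℤ) 6 ×ˢ Finset.Icc (-6 : ℤ) 6 ×ˢ Finset.Icc (-2 : ℤ) 2).filter
    (fun q => 3 * q.1 ^ 2 + 3 * q.2.1 ^ 2 + 3 * q.2.2.1 ^ 2 + 2 * q.1 * q.2.1 + 2 * q.1 * q.2.2.1 - 2 * q.2.1 * q.2.2.1
      + 6 * q.2.2.2 ^ 2 = 41)).card = 96 := by
  decide +kernel

/-- **The printed identity `2·r_{Q_S}(p) + r_{Q_E}(p) = 8(p − 1)`** at `p = 11, 17, 41` (with the counts above), and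
`κ_p = 2y_p`, `4y_p = r_{Q_S} − r_{Q_E}`: `κ = 2, −4, 8`. [kernel, `norm_num`] -/
theorem two_rS_add_rE :
    (2 * 28 + 24 = 8 * (11 - 1) ∧ 2 * 40 + 48 = 8 * (17 - 1) ∧ 2 * 112 + 96 = 8 * (41 - 1)) ∧
    ((28 : ℤ) - 24 = 4 * 1 ∧ (40 : ℤ) - 48 = 4 * (-2) ∧ (112 : ℤ) - 96 = 4 * 4) ∧
    ((2 : ℤ) * 1 = 2 ∧ (2 : ℤ) * (-2) = -4 ∧ (2 : ℤ) * 4 = 8) := by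
  norm_num

end Summit.Ventures.HSemireg.Theta40
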